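import Mathlib
import Summits.CriticalPhenomena.CardyFormulaZ2.Theorems.CardyMagicRigidityDefs
import Summits.CriticalPhenomena.CardyFormulaZ2.Theorems.CardyMagicRigidityPositiveConeDefs
import Summits.CriticalPhenomena.CardyFormulaZ2.Theorems.CardyMagicRigidityNestingRigidityTransferReduction
import Literature.Barriers.CriticalPhenomena.NestingTransformBlindness
import Literature.Topology.PlaneTopology.ArgumentIncrement
import Literature.Probability.RandomPlanarGeometry.LoopWinding
import Literature.Probability.RandomPlanarGeometry.LocFinLoopConfig
import HarnessLib

/-!
# Stub S6 · `Transfer`: `Regular` is not rigid across configurations (route-gap witness)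

Crux `Summit.CriticalPhenomena.CardyFormulaZ2.Theses.CardyMagicRigidity.NestingRigidity`
(stmt-CriticalPhenomena-4835), line `ring-cloud-tomography` (r4), registered stub `stub_transfer : Transfer`
(`NestingStatisticsAgree → LoopLimitZ2EqT`); companion of `…TransferReduction` (p112841: pattern counts see only
winding interiors, `patternCount_eq_of_interiorEquiv`) and `…TransferRigidity`.  It turns the remark closing
those docstrings into a THEOREM for the planners of both lines using `Regular`
(`Theorems/CardyMagicRigidityPositiveConeDefs`; step (ii) of `stub_transfer`, steps (1)–(2) of the sibling
`stub_treeRigidity`): `exists_regular_patternCount_eq_not_isClose` (anchor) — two `Regular` ONE-LOOP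
configurations with the same trace and the same winding interior, hence with ALL pattern counts equal, which
are not `ε`-close in DKKMO's sense for any `ε ∈ (0, 1/3)` (`cnEDist ≥ 1/3`); and its law-level reading
`exists_regular_laws_patternCount_eq_le_cnLawEDist` in the shape of `PrecompactRegular` / `TreeRigidity`
(two surely regular random configurations on `([0,1], Leb)` with surely equal pattern counts for all disc
families at once — so all joint laws of counts agree — at coupling distance `cnLawEDist ≥ 1/3`).

WITNESS: the figure-eights `C₋⁺C₊⁺`, `C₋⁺C₊⁻` on the externally tangent circles of radius `r = 1/3` centred
at `∓r`: the lobe `t ↦ a − a e^{2πit}` through `0` (a Mathlib `Path 0 0`, §1) followed by the right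
lobe anticlockwise (`Path.trans`), resp. clockwise (`Path.symm`).  Winding numbers of Mathlib loops read as
tree curves ADD under concatenation and flip sign under reversal (§2, `Path.argInc_trans`/`argInc_symm`), and
a lobe winds once around its open disc and not around the outside of its closed disc (§2); so
`W(C₋⁺C₊^σ, ·) = 1` on `B(−r,r)`, `σ = ±1` on `B(r,r)`, `0` elsewhere (§3).  Hence both loops have degree
one, interior `B(−r,r) ∪ B(r,r)` and trace = its frontier, and a one-loop configuration with these
properties is `Regular` (§4); the counts agree by `patternCount_eq_of_interiorEquiv`.  But `udist ≥ r`
(§4): an oriented matching closer than `r = dist(±r, trace)` forces `W' = W` at `+r` (`−1 = 1`), a reversing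
one `W' = −W` at `−r` (`−1 = 1`), by `UnbasedLoop.wind_eq_of_dist_lt`; and `C₋⁺C₊⁺ ⊆ B(0, 1/ε)` for
`ε < r ≤ 1/2`, so the configurations are not `ε`-close (§§4–5); §6 is the Dirac-law reading.

MORAL.  Nesting-tree statistics of a regular limit determine at most the law of the MULTISET OF WINDING
INTERIORS; passing to `d_CN` needs `u ↦ {W(u,·) ≠ 0}` injective up to reversal ACROSS the supports of the
two limit laws, whereas `Regular.separating` separates loops WITHIN one configuration.  Sufficient extra
support properties (true on the lattice, expected for CLE₆): (a) SINGLE-SIGNED winding per loop (kills this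
witness; cf. `UnbasedLoop.dist_le_of_udist_le`) AND (b) a CANONICAL TRAVERSAL (loop determined up to reversal
by trace + winding function; kills "circle" vs "circle plus a retraced arc", which (a) does not).  With
`Regular` alone the reconstruction PRINCIPLE "regular + equal nesting statistics ⇒ `d_CN`-close" is false, by
this file (the stubs themselves, about the two lattice limits, are not refuted): (a), (b) or an equivalent
must be added to what `Precompactness` passes to the limit, and used in step (ii) / (2).
-/

noncomputable section

open Set Metric Complex
open scoped Real Topology

namespace Summit.CriticalPhenomena.CardyFormulaZ2.Cruxes.NestingRigidity.RingCloudTomography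

open Literature.Probability.RandomPlanarGeometry
open Literature.Topology.PlaneTopology (int_eq_of_mul_two_pi_I_eq)
open Literature.Barriers.CriticalPhenomena.NestingBlind (single loops_single mem_single_self)
open Summit.CriticalPhenomena.CardyFormulaZ2.Cruxes.NestingRigidity.PositiveConeWeightDoubling (Regular)

/-! ## §1 Circle lobes through the origin -/

/-- **Lobes.**  The circle of centre `a` through the origin traversed once anticlockwise from `0` to `0`,
`t ↦ a − a·e^{2πit}`, as a Mathlib `Path 0 0` (so that lobes can be concatenated with `Path.trans` and
reversed with `Path.symm`).  Below, a *lobe of centre `a`* is any `γ : Path 0 0` with this formula (`hγ`). -/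
private theorem exists_lobe (a : ℂ) : ∃ γ : Path (0 : ℂ) 0, ∀ t, γ t = a - a * exp (2 * π * (t : ℝ) * I) :=
  ⟨{ toFun := fun t ↦ a - a * exp (2 * π * (t : ℝ) * I)
     continuous_toFun := by fun_prop
     source' := by simp
     target' := by
       simp only [Set.Icc.coe_one, ofReal_one, mul_one]
       rw [exp_two_pi_mul_I, mul_one, sub_self] }, fun _ ↦ rfl⟩

/-- A lobe stays at distance `‖a‖` from its centre `a`. -/
private theorem norm_lobe_sub_center {a : ℂ} {γ : Path (0 : ℂ) 0}
    (hγ : ∀ t, γ t = a - a * exp (2 * π * (t : ℝ) * I)) (t : unitInterval) : ‖γ t - a‖ = ‖a‖ := by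
  rw [hγ t, sub_sub_cancel_left, norm_neg, norm_mul,
    show (2 * π * (t : ℝ) * I : ℂ) = ((2 * π * (t : ℝ) : ℝ) : ℂ) * I by push_cast; ring,
    norm_exp_ofReal_mul_I, mul_one]

/-- The trace of a lobe is the whole circle of centre `a` through the origin. -/
private theorem range_lobe {a : ℂ} (ha : a ≠ 0) {γ : Path (0 : ℂ) 0}
    (hγ : ∀ t, γ t = a - a * exp (2 * π * (t : ℝ) * I)) : range γ = sphere a ‖a‖ := by
  refine Subset.antisymm ?_ fun w hw ↦ ?_
  · rintro _ ⟨t, rfl⟩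
    rw [mem_sphere, dist_eq_norm, norm_lobe_sub_center hγ]
  · -- `(a - w)/a` is a unit complex number, hence `e^{iθ}` with `θ ∈ (0, 2π]`
    rw [mem_sphere, dist_eq_norm] at hw
    have hζ : (a - w) / a ∈ sphere (0 : ℂ) |(1 : ℝ)| := by
      rw [mem_sphere, dist_zero_right, norm_div, norm_sub_rev, hw, div_self (norm_ne_zero_iff.2 ha),
        abs_one]
    rw [← image_circleMap_Ioc] at hζ
    obtain ⟨θ, hθ, hθζ⟩ := hζ
    simp only [circleMap, ofReal_one, one_mul, zero_add] at hθζ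
    refine ⟨⟨θ / (2 * π), (div_pos hθ.1 Real.two_pi_pos).le, ?_⟩, ?_⟩
    · rw [div_le_one Real.two_pi_pos]; exact hθ.2
    · have : (2 * π * ((θ / (2 * π) : ℝ) : ℂ) * I : ℂ) = θ * I := by push_cast; field_simp
      rw [hγ, Subtype.coe_mk, this, hθζ, mul_div_cancel₀ _ ha, sub_sub_cancel]

/-! ## §2 Winding numbers: concatenation and reversal of Mathlib loops; lobes -/

/-- For a Mathlib loop `γ : Path x x` and `z ∉ γ`, the argument increment `Path.argInc γ z` is `2πi ×` the
tree's winding number of the curve `Curve.ofPath γ` (both read `γ` on `[0, 1]` through `IccExtend`). -/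
private theorem argInc_eq_wind_ofPath_mul {x : ℂ} (γ : Path x x) {z : ℂ} (hz : z ∉ Set.range γ) :
    γ.argInc z = (Curve.ofPath γ).wind z * (2 * π * I) := by
  rw [Path.argInc_eq_wind_mul γ hz, show (Curve.ofPath γ).wind z = Literature.Topology.PlaneTopology.wind
    (fun t ↦ γ.extend t - z) from Literature.Topology.PlaneTopology.wind_congr fun t ht ↦ by
      rw [Curve.subPt_of_mem _ z ht, Path.extend_apply γ ht, Curve.ofPath_apply]]

/-- A Mathlib loop read as a curve is a loop. -/
private theorem isLoop_ofPath {x : ℂ} (γ : Path x x) : (Curve.ofPath γ).IsLoop := by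
  rw [Curve.isLoop_iff, Curve.source_ofPath, Curve.target_ofPath]

/-- **Winding numbers add under concatenation** of loops at one base point (`Path.argInc_trans`). -/
private theorem wind_ofPath_trans {x : ℂ} (γ₁ γ₂ : Path x x) {z : ℂ} (h₁ : z ∉ Set.range γ₁)
    (h₂ : z ∉ Set.range γ₂) :
    (Curve.ofPath (γ₁.trans γ₂)).wind z = (Curve.ofPath γ₁).wind z + (Curve.ofPath γ₂).wind z := by
  have h : z ∉ Set.range (γ₁.trans γ₂) := by
    rw [Path.trans_range]
    rintro (h | h)
    exacts [h₁ h, h₂ h]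
  have key := Path.argInc_trans γ₁ γ₂ h₁ h₂
  rw [argInc_eq_wind_ofPath_mul _ h, argInc_eq_wind_ofPath_mul _ h₁, argInc_eq_wind_ofPath_mul _ h₂,
    ← add_mul] at key
  exact int_eq_of_mul_two_pi_I_eq (by push_cast; exact key)

/-- **Reversal negates the winding number** (`Path.argInc_symm`). -/
private theorem wind_ofPath_symm {x : ℂ} (γ : Path x x) {z : ℂ} (h : z ∉ Set.range γ) :
    (Curve.ofPath γ.symm).wind z = -(Curve.ofPath γ).wind z := by
  have key := Path.argInc_symm γ h
  rw [argInc_eq_wind_ofPath_mul _ (by rwa [Path.symm_range]), argInc_eq_wind_ofPath_mul _ h,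
    ← neg_mul] at key
  exact int_eq_of_mul_two_pi_I_eq (by push_cast; exact key)

/-- A lobe winds once around its centre (explicit logarithm `log(−a) + 2πit` of `γ t − a`). -/
private theorem wind_lobe_center {a : ℂ} (ha : a ≠ 0) {γ : Path (0 : ℂ) 0}
    (hγ : ∀ t, γ t = a - a * exp (2 * π * (t : ℝ) * I)) : (Curve.ofPath γ).wind a = 1 :=
  Curve.wind_eq_of_log (isLoop_ofPath γ) (l := fun t ↦ log (-a) + 2 * π * t * I) (by fun_prop)
    (fun t ht ↦ by rw [exp_add, exp_log (neg_ne_zero.2 ha), Curve.ofPath_apply, hγ, sub_sub_cancel_left,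
      neg_mul]) (by push_cast; ring)

/-- Off its trace, the winding number of a lobe is the indicator of its open disc (inside: Rouché — moving
the centre by less than the radius keeps `W = 1`; outside: the trace lies in a ball missing the point). -/
private theorem wind_lobe_eq_ite {a : ℂ} (ha : a ≠ 0) {γ : Path (0 : ℂ) 0}
    (hγ : ∀ t, γ t = a - a * exp (2 * π * (t : ℝ) * I)) {z : ℂ} (hz : dist z a ≠ ‖a‖) :
    (Curve.ofPath γ).wind z = if dist z a < ‖a‖ then 1 else 0 := by
  split_ifs with h
  · rw [← wind_lobe_center ha hγ]
    have hloop := isLoop_ofPath γ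
    have hc : a ∉ (Curve.ofPath γ).range := by
      rw [show (Curve.ofPath γ).range = Set.range γ from rfl, range_lobe ha hγ, mem_sphere, dist_self]
      exact fun h ↦ ha (norm_eq_zero.1 h.symm)
    refine Literature.Topology.PlaneTopology.wind_eq_of_norm_sub_lt
      (Curve.continuous_subPt _ z).continuousOn (Curve.subPt_zero_eq_one hloop z)
      (Curve.isNonvanishingLoop_subPt hloop hc) fun t ht ↦ ?_
    rw [Curve.subPt_of_mem _ _ ht, Curve.subPt_of_mem _ _ ht, sub_sub_sub_cancel_left,
      Curve.ofPath_apply, norm_lobe_sub_center hγ, ← dist_eq_norm, dist_comm]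
    exact h
  · refine Curve.wind_eq_zero_of_subset_ball (w := a) (ρ := dist z a) ?_ le_rfl
    rintro _ ⟨t, rfl⟩
    rw [mem_ball, dist_eq_norm, Curve.ofPath_apply, norm_lobe_sub_center hγ]
    exact lt_of_le_of_ne (not_lt.1 h) (Ne.symm hz)

/-! ## §3 Figure-eights on the tangent circles of radius `r` centred at `∓r` -/

/-- The closed left disc misses the open right disc: `dist z (−r) ≤ r ⇒ Re z ≤ 0 ⇒ dist z r ≥ r`. -/
private theorem le_dist_right_of_dist_left_le {r : ℝ} {z : ℂ} (h : dist z (-r : ℂ) ≤ r) :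
    r ≤ dist z (r : ℂ) := by
  rw [dist_eq_norm, sub_neg_eq_add] at h
  have h1 := (le_abs_self _).trans ((Complex.abs_re_le_norm (z + r)).trans h)
  have h2 := (neg_le_abs _).trans (Complex.abs_re_le_norm (z - r))
  simp only [Complex.add_re, Complex.sub_re, Complex.ofReal_re] at h1 h2
  rw [dist_eq_norm]
  linarith

/-- The closed right disc misses the open left disc (the previous lemma at `−z`). -/
private theorem le_dist_left_of_dist_right_le {r : ℝ} {z : ℂ} (h : dist z (r : ℂ) ≤ r) :
    r ≤ dist z (-r : ℂ) := by
  rw [← dist_neg_neg, neg_neg]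
  exact le_dist_right_of_dist_left_le (by rwa [dist_neg_neg])

/-- The frontier of the union of the two tangent open discs is the union of the two circles. -/
private theorem frontier_ball_union_ball {r : ℝ} (hr : 0 < r) :
    frontier (ball (-r : ℂ) r ∪ ball (r : ℂ) r) = sphere (-r : ℂ) r ∪ sphere (r : ℂ) r := by
  rw [frontier, closure_union, closure_ball _ hr.ne', closure_ball _ hr.ne',
    (isOpen_ball.union isOpen_ball).interior_eq]
  ext z
  simp only [mem_sdiff, mem_union, mem_closedBall, mem_ball, mem_sphere, not_or, not_lt]
  constructor
  · rintro ⟨h | h, h₁, h₂⟩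
    exacts [Or.inl (le_antisymm h h₁), Or.inr (le_antisymm h h₂)]
  · rintro (h | h)
    exacts [⟨.inl h.le, h.ge, le_dist_right_of_dist_left_le h.le⟩, ⟨.inr h.le, le_dist_left_of_dist_right_le h.le, h.ge⟩]

/-- **Trace and winding numbers of a figure-eight.**  If `γ₁` has trace the left circle and, off it, winding
number `𝟙[B(−r,r)]`, and `γ₂` has trace the right circle and, off it, winding number `σ·𝟙[B(r,r)]`, then the
unbased loop `u` of `γ₁ ∗ γ₂` has trace the two circles and, EVERYWHERE, `W(u, ·) = (1 on B(−r,r); σ on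
B(r,r); 0 elsewhere)` (additivity off the trace; `wind = 0` on the trace; the closed discs only touch). -/
private theorem fig_spec {r : ℝ} {σ : ℤ} {γ₁ γ₂ : Path (0 : ℂ) 0} {u : UnbasedLoop ℂ}
    (h₁r : Set.range γ₁ = sphere (-r : ℂ) r)
    (h₁w : ∀ z, dist z (-r : ℂ) ≠ r → (Curve.ofPath γ₁).wind z = if dist z (-r : ℂ) < r then 1 else 0)
    (h₂r : Set.range γ₂ = sphere (r : ℂ) r)
    (h₂w : ∀ z, dist z (r : ℂ) ≠ r → (Curve.ofPath γ₂).wind z = σ * if dist z (r : ℂ) < r then 1 else 0)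
    (hur : u.range = Set.range (γ₁.trans γ₂)) (huw : ∀ z, u.wind z = (Curve.ofPath (γ₁.trans γ₂)).wind z) :
    u.range = sphere (-r : ℂ) r ∪ sphere (r : ℂ) r ∧
      ∀ z, u.wind z = if dist z (-r : ℂ) < r then 1 else if dist z (r : ℂ) < r then σ else 0 := by
  have hrange : u.range = sphere (-r : ℂ) r ∪ sphere (r : ℂ) r := by rw [hur, Path.trans_range, h₁r, h₂r]
  refine ⟨hrange, fun z ↦ ?_⟩
  by_cases hza : dist z (-r : ℂ) = r
  · rw [unbasedLoop_wind_of_mem_range _ (by rw [hrange]; exact Or.inl hza),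
      if_neg (by rw [hza]; exact lt_irrefl r), if_neg (not_lt.2 (le_dist_right_of_dist_left_le hza.le))]
  by_cases hzb : dist z (r : ℂ) = r
  · rw [unbasedLoop_wind_of_mem_range _ (by rw [hrange]; exact Or.inr hzb),
      if_neg (not_lt.2 (le_dist_left_of_dist_right_le hzb.le)), if_neg (by rw [hzb]; exact lt_irrefl r)]
  rw [huw, wind_ofPath_trans _ _ (by rwa [h₁r, mem_sphere]) (by rwa [h₂r, mem_sphere]), h₁w z hza,
    h₂w z hzb]
  split_ifs with h₁ h₂
  · exact absurd h₂ (not_lt.2 (le_dist_right_of_dist_left_le h₁.le))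
  all_goals simp

/-! ## §4 Such a loop, alone, forms a `Regular` configuration; but the two are `udist`-far -/

/-- A one-loop configuration whose loop has trace the two circles and the model winding function, `σ = ±1`,
is `Regular` with winding interior the two open discs: degree one and the boundary property are read off the
formula (`frontier_ball_union_ball`); local finiteness, laminarity, separation are automatic for one loop. -/
private theorem regular_single_of_fig {r : ℝ} (hr : 0 < r) {σ : ℤ} (hσ : σ = 1 ∨ σ = -1)
    {u : UnbasedLoop ℂ} (hrange : u.range = sphere (-r : ℂ) r ∪ sphere (r : ℂ) r)
    (hw : ∀ z, u.wind z = if dist z (-r : ℂ) < r then 1 else if dist z (r : ℂ) < r then σ else 0) :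
    {z | u.wind z ≠ 0} = ball (-r : ℂ) r ∪ ball (r : ℂ) r ∧ Regular (single 0 u) := by
  have hσ0 : σ ≠ 0 := by rcases hσ with rfl | rfl <;> decide
  have hint : {z | u.wind z ≠ 0} = ball (-r : ℂ) r ∪ ball (r : ℂ) r := by
    ext z
    simp only [mem_setOf_eq, hw z, mem_union, mem_ball]
    by_cases h₁ : dist z (-r : ℂ) < r <;> by_cases h₂ : dist z (r : ℂ) < r <;> simp [h₁, h₂, hσ0]
  have hmem : ∀ v ∈ (single 0 u).loops, v = u := fun v hv ↦ by simpa using hv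
  refine ⟨hint, ⟨?_, fun v hv z ↦ ?_, fun v hv ↦ ?_, fun v hv w hw' ↦ ?_, fun v hv w hw' _ ↦ ?_⟩⟩
  · exact LoopConfig.IsLocallyFinite.of_finite fun i ↦ by fin_cases i <;> simp [single]
  · rw [hmem v hv, hw z]
    rcases hσ with rfl | rfl <;> split_ifs <;> simp
  · rw [hmem v hv, hint, frontier_ball_union_ball hr, hrange]
  · rw [hmem v hv, hmem w hw']
    exact Or.inl subset_rfl
  · rw [hmem v hv, hmem w hw']
    exact Or.inl rfl

/-- **`udist(C₋⁺C₊⁺, C₋⁺C₊⁻) ≥ r`.**  Both centres `∓r` are at distance `≥ r` from the common trace; if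
`udist < r` then either `dist < r` and `W(·, r)` would agree (`−1 = 1`), or `dist(·, reverse ·) < r` and
`W(·, −r)` would agree up to sign (`−1 = 1`), by `UnbasedLoop.wind_eq_of_dist_lt`. -/
private theorem le_udist_of_fig {r : ℝ} (hr : 0 < r) {u u' : UnbasedLoop ℂ}
    (hrange : u.range = sphere (-r : ℂ) r ∪ sphere (r : ℂ) r)
    (hw : ∀ z, u.wind z = if dist z (-r : ℂ) < r then 1 else if dist z (r : ℂ) < r then 1 else 0)
    (hw' : ∀ z, u'.wind z = if dist z (-r : ℂ) < r then 1 else if dist z (r : ℂ) < r then -1 else 0) :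
    r ≤ u.udist u' := by
  have hia : r ≤ infDist (-r : ℂ) u.range ∧ r ≤ infDist (r : ℂ) u.range := by
    rw [Metric.le_infDist (UnbasedLoop.range_nonempty u),
      Metric.le_infDist (UnbasedLoop.range_nonempty u), hrange]
    refine ⟨?_, ?_⟩ <;> rintro y (hy | hy) <;> rw [mem_sphere] at hy <;> rw [dist_comm]
    exacts [hy.ge, le_dist_left_of_dist_right_le hy.le, le_dist_right_of_dist_left_le hy.le, hy.ge]
  have h2r : ¬ dist (r : ℂ) (-r : ℂ) < r := by
    rw [dist_eq_norm, sub_neg_eq_add, ← two_mul, norm_mul, Complex.norm_two,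
      Complex.norm_of_nonneg hr.le]
    linarith
  by_contra h
  rw [not_le, UnbasedLoop.udist_def, min_lt_iff] at h
  rcases h with h | h
  · have key := UnbasedLoop.wind_eq_of_dist_lt (h.trans_le hia.2)
    rw [hw', hw, if_neg h2r, if_neg h2r, dist_self, if_pos hr, if_pos hr] at key
    norm_num at key
  · have key := UnbasedLoop.wind_eq_of_dist_lt (h.trans_le hia.1)
    rw [UnbasedLoop.wind_reverse, hw', hw, dist_self, if_pos hr, if_pos hr] at key
    norm_num at key

/-! ## §5 The witness -/

/-- **All claims, for an abstract pair** `u`, `u'` with the trace and the winding functions of `C₋⁺C₊⁺`,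
`C₋⁺C₊⁻` at radius `r ∈ (0, 1/2]`, filed alone under type `0`.  Not `ε`-close for `0 < ε < r`: `u` lies in
the window `B(0, 1/ε)` (its trace has norm `≤ 2r ≤ 1 < 1/ε`) and its only candidate partner `u'` is at
unoriented distance `≥ r > ε`; equal counts: the interior-preserving bijection `u ↦ u'`. -/
private theorem witness {r : ℝ} (hr : 0 < r) (hr2 : r ≤ 1 / 2) {u u' : UnbasedLoop ℂ}
    (hru : u.range = sphere (-r : ℂ) r ∪ sphere (r : ℂ) r) (hru' : u'.range = sphere (-r : ℂ) r ∪ sphere (r : ℂ) r)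
    (hw : ∀ z, u.wind z = if dist z (-r : ℂ) < r then 1 else if dist z (r : ℂ) < r then 1 else 0)
    (hw' : ∀ z, u'.wind z = if dist z (-r : ℂ) < r then 1 else if dist z (r : ℂ) < r then -1 else 0) :
    ∃ c c' : LoopConfig ℂ, Regular c ∧ Regular c' ∧
      (∃ u u' : UnbasedLoop ℂ, c.loops = {u} ∧ c'.loops = {u'} ∧ u'.range = u.range ∧
        {z | u'.wind z ≠ 0} = {z | u.wind z ≠ 0} ∧ r ≤ u.udist u') ∧
      (∀ (n : ℕ) (x : Fin n → ℂ) (ρ : Fin n → ℝ) (R : ℝ) (S : Finset (Fin n)),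
        patternCount c x ρ R S = patternCount c' x ρ R S) ∧
      (∀ ε : ℝ, 0 < ε → ε < r → ¬ LoopConfig.IsClose ε c c') ∧ ENNReal.ofReal r ≤ LoopConfig.cnEDist c c' := by
  obtain ⟨hint, hreg⟩ := regular_single_of_fig hr (Or.inl rfl) hru hw
  obtain ⟨hint', hreg'⟩ := regular_single_of_fig hr (Or.inr rfl) hru' hw'
  have hud : r ≤ u.udist u' := le_udist_of_fig hr hru hw hw'
  have hnot : ∀ ε : ℝ, 0 < ε → ε < r → ¬ LoopConfig.IsClose ε (single 0 u) (single 0 u') := by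
    intro ε hε hεr h
    have hε1 : (1 : ℝ) < 1 / ε := one_lt_one_div hε (by linarith)
    have hball : u.range ⊆ ball (0 : ℂ) (1 / ε) := by
      rw [hru]
      rintro y (hy | hy) <;> rw [mem_sphere, dist_eq_norm] at hy <;> rw [mem_ball, dist_zero_right]
      · have := norm_le_insert' y (-r : ℂ)
        rw [norm_neg, Complex.norm_of_nonneg hr.le, hy] at this
        linarith
      · have := norm_le_insert' y (r : ℂ)
        rw [Complex.norm_of_nonneg hr.le, hy] at this
        linarith
    obtain ⟨v, hv, hd⟩ := (h 0).1 _ (mem_single_self 0 _) hball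
    have hvu : v = u' := by simpa [single] using hv
    exact not_le.2 hεr (hud.trans (hvu ▸ hd))
  refine ⟨_, _, hreg, hreg', ⟨u, u', loops_single 0 u, loops_single 0 u', by rw [hru, hru'],
    by rw [hint, hint'], hud⟩, fun n x ρ R S ↦ ?_, hnot, ?_⟩
  · have hmem : ∀ v : (single 0 u).loops, (v : UnbasedLoop ℂ) = u := fun v ↦
      mem_singleton_iff.1 ((loops_single 0 u).subset v.2)
    have hmem' : ∀ v : (single 0 u').loops, (v : UnbasedLoop ℂ) = u' := fun v ↦
      mem_singleton_iff.1 ((loops_single 0 u').subset v.2)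
    let e : (single 0 u).loops ≃ (single 0 u').loops :=
      { toFun := fun _ ↦ ⟨u', by rw [loops_single]; exact mem_singleton _⟩
        invFun := fun _ ↦ ⟨u, by rw [loops_single]; exact mem_singleton _⟩
        left_inv := fun v ↦ Subtype.ext (hmem v).symm
        right_inv := fun v ↦ Subtype.ext (hmem' v).symm }
    refine patternCount_eq_of_interiorEquiv hreg.boundary hreg'.boundary e (fun v ↦ ?_) x ρ R S
    rw [show ((e v : (single 0 u').loops) : UnbasedLoop ℂ) = u' from rfl, hmem v, hint, hint']
  · simp only [LoopConfig.cnEDist, le_iInf_iff]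
    exact fun ε hε hclose ↦ ENNReal.ofReal_le_ofReal (not_lt.1 fun hεr ↦ hnot ε hε hεr hclose)

/-- **`Regular` is not rigid across configurations — route-gap witness for the reconstruction step of
`stub_transfer` (this line) and `stub_treeRigidity` (line `positive-cone-weight-doubling`).**  There are two
configurations `c`, `c'` of the plane, both `Regular` (locally finite, covering degree one, trace = frontier
of the winding interior, laminar, separating), each ONE loop of type `0`, the two loops having the SAME trace
and the SAME winding interior — so ALL pattern counts of `c`, `c'` coincide (every number of discs, centres,
radii, window, index set) — at unoriented distance `udist ≥ 1/3`, so that `c`, `c'` are not `ε`-close in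
DKKMO's sense for any `ε ∈ (0, 1/3)` and `cnEDist c c' ≥ 1/3`.  (Witness: the figure-eights `C₋⁺C₊⁺`,
`C₋⁺C₊⁻` of radius `1/3`; see the module docstring for the moral.) -/
theorem exists_regular_patternCount_eq_not_isClose :
    ∃ c c' : LoopConfig ℂ, Regular c ∧ Regular c' ∧
      (∃ u u' : UnbasedLoop ℂ, c.loops = {u} ∧ c'.loops = {u'} ∧ u'.range = u.range ∧
        {z | u'.wind z ≠ 0} = {z | u.wind z ≠ 0} ∧ 1 / 3 ≤ u.udist u') ∧
      (∀ (n : ℕ) (x : Fin n → ℂ) (ρ : Fin n → ℝ) (R : ℝ) (S : Finset (Fin n)),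
        patternCount c x ρ R S = patternCount c' x ρ R S) ∧
      (∀ ε : ℝ, 0 < ε → ε < 1 / 3 → ¬ LoopConfig.IsClose ε c c') ∧
      ENNReal.ofReal (1 / 3) ≤ LoopConfig.cnEDist c c' := by
  have hr : (0 : ℝ) < 1 / 3 := by norm_num
  have ha : ((1 / 3 : ℝ) : ℂ) ≠ 0 := Complex.ofReal_ne_zero.2 hr.ne'
  have hna : ‖((1 / 3 : ℝ) : ℂ)‖ = 1 / 3 := Complex.norm_of_nonneg hr.le
  have hna' : ‖(-(1 / 3 : ℝ) : ℂ)‖ = 1 / 3 := by rw [norm_neg, hna]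
  obtain ⟨γ₁, hγ₁⟩ := exists_lobe (-(1 / 3 : ℝ) : ℂ)
  obtain ⟨γ₂, hγ₂⟩ := exists_lobe ((1 / 3 : ℝ) : ℂ)
  have h₁r : Set.range γ₁ = sphere (-(1 / 3 : ℝ) : ℂ) (1 / 3) := by rw [range_lobe (neg_ne_zero.2 ha) hγ₁, hna']
  have h₁w : ∀ z, dist z (-(1 / 3 : ℝ) : ℂ) ≠ 1 / 3 →
      (Curve.ofPath γ₁).wind z = if dist z (-(1 / 3 : ℝ) : ℂ) < 1 / 3 then 1 else 0 := fun z hz ↦ by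
    rw [wind_lobe_eq_ite (neg_ne_zero.2 ha) hγ₁ (by rwa [hna']), hna']
  have h₂r : Set.range γ₂ = sphere ((1 / 3 : ℝ) : ℂ) (1 / 3) := by rw [range_lobe ha hγ₂, hna]
  -- `C₋⁺C₊⁺` (second lobe anticlockwise) and `C₋⁺C₊⁻` (second lobe clockwise), as unbased loops
  obtain ⟨hru, hw⟩ := fig_spec (σ := 1) h₁r h₁w h₂r (fun z hz ↦ by
    rw [wind_lobe_eq_ite ha hγ₂ (by rwa [hna]), hna, one_mul]) rfl (fun _ ↦ rfl)
    (u := UnbasedLoop.mk (BasedLoop.mk (CurveClass.mk (Curve.ofPath (γ₁.trans γ₂)))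
      (CurveClass.isLoop_mk.2 (isLoop_ofPath _))))
  obtain ⟨hru', hw'⟩ := fig_spec (σ := -1) h₁r h₁w (by rw [Path.symm_range, h₂r]) (fun z hz ↦ by
    rw [wind_ofPath_symm _ (by rwa [h₂r, mem_sphere]), wind_lobe_eq_ite ha hγ₂ (by rwa [hna]), hna,
      neg_one_mul]) rfl (fun _ ↦ rfl)
    (u := UnbasedLoop.mk (BasedLoop.mk (CurveClass.mk (Curve.ofPath (γ₁.trans γ₂.symm)))
      (CurveClass.isLoop_mk.2 (isLoop_ofPath _))))
  exact witness hr (by norm_num) hru hru' hw hw'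

/-! ## §6 Law-level form: two deterministic regular "limits" on `([0,1], Leb)` -/

/-- Deterministic configurations that are not `ε`-close for any `ε ∈ (0, r)`, `r ≤ 1`, have laws at
coupling distance `≥ r` under any presentation (every coupling charges the sure event). -/
private theorem le_cnLawEDist_const {Ω Ω' : Type*} [MeasurableSpace Ω] [MeasurableSpace Ω']
    (P : MeasureTheory.Measure Ω) (P' : MeasureTheory.Measure Ω') [MeasureTheory.IsProbabilityMeasure P]
    {c c' : LoopConfig ℂ} {r : ℝ} (hr1 : r ≤ 1)
    (h : ∀ ε : ℝ, 0 < ε → ε < r → ¬ LoopConfig.IsClose ε c c') :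
    ENNReal.ofReal r ≤ LoopConfig.cnLawEDist P (fun _ ↦ c) P' (fun _ ↦ c') := by
  simp only [LoopConfig.cnLawEDist, le_iInf_iff]
  refine fun ε hε Q h1 _ hQ ↦ ENNReal.ofReal_le_ofReal (not_lt.1 fun hεr ↦ ?_)
  have hQ1 : Q univ = 1 := by
    simpa [MeasureTheory.Measure.map_apply measurable_fst MeasurableSet.univ] using
      congrArg (fun ν : MeasureTheory.Measure Ω ↦ ν univ) h1
  rw [show {p : Ω × Ω' | ¬ LoopConfig.IsClose ε c c'} = univ from eq_univ_of_forall fun _ ↦ h ε hε hεr,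
    hQ1] at hQ
  exact absurd (hQ.trans_le (ENNReal.ofReal_le_one.2 (hεr.le.trans hr1))) (lt_irrefl 1)

/-- **Law-level form, in the shape of `TreeRigidity` / `PrecompactRegular`.**  Two random configurations on
`([0,1], Leb)` (deterministic), both surely `Regular`, with surely equal pattern counts for every disc family,
window and index set simultaneously (so every joint law of counts agrees, in particular the cylinder
probabilities of `NestingStatisticsAgree` / `NestingLawAgreement`), at coupling distance `cnLawEDist ≥ 1/3`:
"regular limits + equal nesting-tree statistics ⇒ laws `d_CN`-equal" is false for regular laws in general. -/
theorem exists_regular_laws_patternCount_eq_le_cnLawEDist :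
    ∃ X X' : unitInterval → LoopConfig ℂ, (∀ s, Regular (X s)) ∧ (∀ s, Regular (X' s)) ∧
      (∀ (s : unitInterval) (n : ℕ) (x : Fin n → ℂ) (ρ : Fin n → ℝ) (R : ℝ) (S : Finset (Fin n)),
        patternCount (X s) x ρ R S = patternCount (X' s) x ρ R S) ∧
      ENNReal.ofReal (1 / 3) ≤ LoopConfig.cnLawEDist MeasureTheory.volume X MeasureTheory.volume X' := by
  obtain ⟨c, c', hc, hc', -, hcount, hnot, -⟩ := exists_regular_patternCount_eq_not_isClose
  exact ⟨fun _ ↦ c, fun _ ↦ c', fun _ ↦ hc, fun _ ↦ hc', fun _ ↦ hcount,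
    le_cnLawEDist_const _ _ (by norm_num) hnot⟩

end Summit.CriticalPhenomena.CardyFormulaZ2.Cruxes.NestingRigidity.RingCloudTomography

end
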